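import Mathlib
import Summits.Ventures.HodgeRepro.Tier4.Line4.SuppMeasure

/-!
# Tier4/Line4/SuppMeasureFinite — the unfolded support measure is FINITE under PROPER and ZDOMAIN-EX (iv)

Blind re-derivation cell `pub-hodge-repro`, Tier 4 «prove the step» (README §9–§10), seat t4-L2-p1 (gen 3; plan-4 g5
S15199 (2) / crit-1 S15187: «either take the RATIO display in `ℝ≥0∞` or carry `suppMeasure … N γ₀ ≠ ⊤` — L2-p1: `hfin`
under PROPER + ZDOMAIN-EX (iv)»).  Tree path `lean/Summits/Ventures/HodgeRepro/Tier4/Line4/SuppMeasureFinite.lean`.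
Imports `Line4/SuppMeasure` (p704106; through it IntegProper's `mem_compact_of_hasProperFinOrbit`).  Mathlib-level.

`suppMeasure_ne_top`: for `γ₀` with PROPER (`hprop : HasProperFinOrbit W γ₀,f`-shape at the finite part, exactly the
binder of INTEG (B1)/(C-hIfin)/(D)) and a domain `DZ_f` relatively compact on `Z_f`-saturations of compacts (`hDZc`), the set
`suppSet γ₀ N γ₀ ∩ (DZ_f × T′_f)` lies in a compact `K₁ × K₂` (`mem_compact_of_hasProperFinOrbit` at `C := K(N) γ₀,f K(N)`),
hence has finite `ν_f ⊗ ν′_f`-measure; the same for any `γ` with PROPER at `γ` (`suppMeasure_ne_top_of_hasProperFinOrbit`).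
So `levelNorm_le_suppMeasure`'s `hfin` is discharged and the RATIO display may stay in `ℝ`.

Nothing here says anything about the status of the Hodge conjecture for CM abelian varieties, which is NOT proved
(HC_CM is NOT proved by anyone in this repository).
-/

set_option autoImplicit false
noncomputable section
namespace Summit.Ventures.HodgeRepro.Tier4.Line4
open Summit.Ventures.HodgeRepro.Tier4 Summit.Ventures.HodgeRepro.Tier4.Common
  Summit.Ventures.HodgeRepro.Tier4.Line1 MeasureTheory
open scoped Topology Pointwise NNReal ENNReal

section Finite
variable {k : Type} [Field k] [NumberField k] (W : PlaneData k) [MeasurableSpace (GA W)]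
  (νf : Measure (torusFin W)) (νf' : Measure (torusFin' W)) (γ₀ : GA W) (DZf : Set (torusFin W))

/-- **The unfolded support measure at `γ` is finite** when the orbit map at `γ` is proper modulo the diagonal centre and
`DZ_f` is relatively compact on `Z_f`-saturations of compacts: the set lies in a compact `K₁ × K₂`. -/
theorem suppMeasure_ne_top_of_hasProperFinOrbit [νf.IsHaarMeasure] [νf'.IsHaarMeasure]
    (hDZc : ∀ C : Set (torusFin W), IsCompact C → IsCompact (closure (DZf ∩ (C * (ZfIn W : Set (torusFin W))))))
    {N : ℕ} (hN : N ≠ 0) (γ : GA W) (hprop : HasProperFinOrbit W γ) :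
    suppMeasure W νf νf' γ₀ DZf N γ ≠ ⊤ := by
  obtain ⟨K₁, K₂, hK₁, hK₂, hmem⟩ :=
    mem_compact_of_hasProperFinOrbit W γ hprop DZf hDZc _ (isCompact_levelDoubleCoset W hN (GA.ofFinPart W γ₀))
  have hsub : suppSet W γ₀ N γ ∩ DZf ×ˢ Set.univ ⊆ K₁ ×ˢ K₂ := by
    rintro p ⟨hp, hpD, -⟩
    exact hmem p hpD hp
  exact ne_top_of_le_ne_top (hK₁.prod hK₂).measure_lt_top.ne (measure_mono hsub)

/-- **The unit of the level-measure assembly is finite**: `suppMeasure N γ₀ ≠ ⊤` under PROPER at `γ₀` and ZDOMAIN-EX (iv). -/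
theorem suppMeasure_ne_top [νf.IsHaarMeasure] [νf'.IsHaarMeasure]
    (hDZc : ∀ C : Set (torusFin W), IsCompact C → IsCompact (closure (DZf ∩ (C * (ZfIn W : Set (torusFin W))))))
    {N : ℕ} (hN : N ≠ 0) (hprop : HasProperFinOrbit W γ₀) :
    suppMeasure W νf νf' γ₀ DZf N γ₀ ≠ ⊤ :=
  suppMeasure_ne_top_of_hasProperFinOrbit W νf νf' γ₀ DZf hDZc hN γ₀ hprop

end Finite

/-! ## Positivity (append, 07:2xZ): the unit is positive — `hv` of the level-measure assembly -/

section Positive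
variable {k : Type} [Field k] [NumberField k] (W : PlaneData k) [MeasurableSpace (GA W)]
  (νf : Measure (torusFin W)) (νf' : Measure (torusFin' W)) (γ₀ : GA W) (DZf : Set (torusFin W))

/-- **The unit is positive**: `0 < (suppMeasure N γ₀).toReal` once `levelTf N ⊆ DZ_f` (`levelNorm_le_suppMeasure` and
`levelNorm_pos`; finiteness from `suppMeasure_ne_top` or any other source) — the `hv` binder of
`exists_fibreDominated_of_level_decay_count` for `v N := levelNorm N⁻¹ · (suppMeasure N γ₀).toReal`. -/
theorem suppMeasure_toReal_pos [νf.IsHaarMeasure] [νf'.IsHaarMeasure] {N : ℕ} (hN : N ≠ 0)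
    (hDZ : levelTf W N ⊆ DZf) (hfin : suppMeasure W νf νf' γ₀ DZf N γ₀ ≠ ⊤) :
    0 < (suppMeasure W νf νf' γ₀ DZf N γ₀).toReal :=
  lt_of_lt_of_le (levelNorm_pos W νf νf' hN) (levelNorm_le_suppMeasure W νf νf' γ₀ DZf N hDZ hfin)

/-- `suppMeasure N γ₀ ≠ 0` under the same hypotheses. -/
theorem suppMeasure_ne_zero [νf.IsHaarMeasure] [νf'.IsHaarMeasure] {N : ℕ} (hN : N ≠ 0)
    (hDZ : levelTf W N ⊆ DZf) (hfin : suppMeasure W νf νf' γ₀ DZf N γ₀ ≠ ⊤) :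
    suppMeasure W νf νf' γ₀ DZf N γ₀ ≠ 0 := by
  intro h0
  have := suppMeasure_toReal_pos W νf νf' γ₀ DZf hN hDZ hfin
  rw [h0, ENNReal.toReal_zero] at this
  exact lt_irrefl _ this

/-- **`hv` in the unit of record**: `0 < levelNorm N⁻¹ · (suppMeasure N γ₀).toReal`. -/
theorem levelNorm_inv_mul_suppMeasure_pos [νf.IsHaarMeasure] [νf'.IsHaarMeasure] {N : ℕ} (hN : N ≠ 0)
    (hDZ : levelTf W N ⊆ DZf) (hfin : suppMeasure W νf νf' γ₀ DZf N γ₀ ≠ ⊤) :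
    0 < (levelNorm W νf νf' N)⁻¹ * (suppMeasure W νf νf' γ₀ DZf N γ₀).toReal :=
  mul_pos (inv_pos.2 (levelNorm_pos W νf νf' hN)) (suppMeasure_toReal_pos W νf νf' γ₀ DZf hN hDZ hfin)

end Positive

end Summit.Ventures.HodgeRepro.Tier4.Line4

end
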